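import Literature.Topology.FourManifolds.CapBlend
import Literature.Topology.FourManifolds.CollarUniquenessBall
import HarnessLib

/-!
# Extending a cap-fixing germ to a ball-preserving diffeomorphism near the closed ball

Topic `Literature/Topology/FourManifolds`; second half of the cap germ alignment used by the fact
seat of Alexander's theorem
(`provefact-Literature.Topology.FourManifolds.SphereEmbedding.schoenflies_exists_ball`, Schultens
(2014), Thm. 3.2.5, Lemma 3.2.3).  **Everything in this file is proved; no definitions, no named
facts.**

With the data of `CapBlend.lean` (`ι` smooth with injective differential, `= id` on the unit
sphere inside `W₁`, ball-preserving there; a cutoff `ρ` supported over a compact `K ⊆ W₁`), the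
blend `b = id + ρ (ι - id)` restricted to the inner closed shell is an inner collar of the unit
sphere (`isInnerCollar_blend`), so the tree's uniqueness of collars
(`IsInnerCollar.exists_openPartialHomeomorph_extend`, `CollarUniquenessBall.lean`; Hirsch (1976),
Ch. 8, Thm. 1.8) extends it over the open ball; glued with `b` outside, this gives
`CapBlend.exists_ballPreserving_extension`: **a smooth injective map `Λ` on a neighbourhood of the
closed unit ball, with smooth inverse, carrying the open ball onto itself and fixing the sphere,
which agrees with the blend `b` (hence with `ι` where `ρ = 1`) near and outside the sphere.**

## References
* M. W. Hirsch, *Differential Topology*, GTM 33 (1976), Ch. 8 §1 Thm. 1.8.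
* J. Schultens, *Introduction to 3-Manifolds*, GSM 151 (2014), Lemma 3.2.3, Thm. 3.2.5.
-/

open scoped RealInnerProductSpace Topology ContDiff
open Set Filter Metric Function

noncomputable section

namespace Literature.Topology.FourManifolds

namespace CapBlend

variable {E : Type*} [NormedAddCommGroup E] [InnerProductSpace ℝ E] [FiniteDimensional ℝ E]
  {ι : E → E} {ρ : E → ℝ} {W₁ K : Set E}

/-- **The blend is an inner collar of the unit sphere** (on a thin closed inner shell, with the
inverse of `exists_shell_inverse`). [folklore] -/
theorem exists_isInnerCollar_blend (hW₁ : IsOpen W₁) (hid : ∀ x ∈ W₁, ‖x‖ = 1 → ι x = x)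
    (hin : ∀ x ∈ W₁, ‖x‖ < 1 → ‖ι x‖ < 1) (hι : ContDiff ℝ ∞ ι)
    (hDι : ∀ x, Injective (fderiv ℝ ι x))
    (hρs : ContDiffOn ℝ ∞ ρ {0}ᶜ) (hρ01 : ∀ x, ρ x ∈ Icc (0 : ℝ) 1)
    (hKc : IsCompact K) (hKW : K ⊆ W₁)
    (hρK : ∀ x : E, x ≠ 0 → ρ x ≠ 0 → ‖x‖⁻¹ • x ∈ K) :
    ∃ (V : Set E) (g : E → E) (ε : ℝ), IsOpen V ∧ 0 < ε ∧ ε ≤ 1 ∧ V ⊆ {0}ᶜ ∧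
      (∀ x : E, |‖x‖ - 1| < ε → x ∈ V) ∧
      InjOn (fun x => x + ρ x • (ι x - x)) V ∧
      (∀ S : Set E, IsOpen S → S ⊆ V → IsOpen ((fun x => x + ρ x • (ι x - x)) '' S)) ∧
      (∀ y : E, |‖y‖ - 1| < ε → y ∈ (fun x => x + ρ x • (ι x - x)) '' V) ∧
      ContDiffOn ℝ ∞ g ((fun x => x + ρ x • (ι x - x)) '' V) ∧
      (∀ x ∈ V, g (x + ρ x • (ι x - x)) = x) ∧
      (∀ y ∈ (fun x => x + ρ x • (ι x - x)) '' V, (g y + ρ (g y) • (ι (g y) - g y)) = y ∧ g y ∈ V) ∧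
      (∀ x : E, 1 < ‖x‖ → ‖x‖ < 1 + ε → 1 < ‖x + ρ x • (ι x - x)‖) ∧
      (∀ x : E, 1 - ε < ‖x‖ → ‖x‖ < 1 → ‖x + ρ x • (ι x - x)‖ < 1) ∧
      IsInnerCollar ε (fun x => x + ρ x • (ι x - x)) g := by
  obtain ⟨V, g, ε, hVo, hε, hV0, hshellV, hinjV, -, hopen, hshellIm, hgs, hleft, hright⟩ :=
    exists_shell_inverse hW₁ hid hin hι hDι hρs hρ01 hKc.isClosed hKW hρK
  obtain ⟨ε₁, hε₁, hcone⟩ := exists_cone_subset hW₁ hKc hKW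
  obtain ⟨ε₃, hε₃, hout⟩ := one_lt_norm_blend hW₁ hid hin hι hDι hρs hρ01 hKc.isClosed hKW hρK
  set ε' : ℝ := min (min ε (min ε₁ 1)) ε₃ with hε'
  have hε'pos : 0 < ε' := lt_min (lt_min hε (lt_min hε₁ one_pos)) hε₃
  have hε'ε : ε' ≤ ε := (min_le_left _ _).trans (min_le_left _ _)
  have hε'1 : ε' ≤ 1 := (min_le_left _ _).trans ((min_le_right _ _).trans (min_le_right _ _))
  have hε'ε₁ : ε' ≤ ε₁ := (min_le_left _ _).trans ((min_le_right _ _).trans (min_le_left _ _))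
  have hε'ε₃ : ε' ≤ ε₃ := min_le_right _ _
  have hcone' : ∀ x : E, x ≠ 0 → ‖x‖⁻¹ • x ∈ K → |‖x‖ - 1| < min ε₁ 1 → x ∈ W₁ := fun x hx hxK h =>
    hcone x hx hxK (lt_of_lt_of_le h (min_le_left _ _))
  have hε'm : ε' ≤ min ε₁ 1 := le_min hε'ε₁ hε'1
  have hinner : ∀ x : E, 1 - ε' < ‖x‖ → ‖x‖ < 1 → ‖x + ρ x • (ι x - x)‖ < 1 := fun x h1 h2 =>
    norm_blend_lt_one hρ01 hin hρK (min_le_right _ _) hcone' (by linarith) h2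
  have hshell_sub : ∀ x ∈ (closedShell ε' : Set E), x ∈ V := by
    intro x hx
    rw [mem_closedShell_iff] at hx
    exact hshellV x (by rw [abs_lt]; constructor <;> linarith)
  refine ⟨V, g, ε', hVo, hε'pos, hε'1, hV0, fun x hx => hshellV x (lt_of_lt_of_le hx hε'ε), hinjV, hopen,
    fun y hy => hshellIm y (lt_of_lt_of_le hy hε'ε), hgs, hleft, hright,
    fun x h1 h2 => hout x h1 (lt_of_lt_of_le h2 (by linarith)), hinner, ?_⟩
  exact
    { pos := hε'pos
      contDiffOn := (contDiffOn_blend hι hρs).mono fun x hx => hV0 (hshell_sub x hx)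
      contDiffOn_symm := hgs.mono fun y hy => by
        rw [mem_closedShell_iff] at hy
        exact hshellIm y (by rw [abs_lt]; constructor <;> linarith)
      eq_self := fun x hx => blend_eq_self_of_norm_eq_one hid hKW hρK hx
      norm_le_one := fun x hx => by
        rw [mem_closedShell_iff] at hx
        exact norm_blend_le_one hρ01 hid hKW hin hρK (min_le_right _ _) hcone'
          (by linarith) hx.2
      norm_lt_one := fun x hx h => by
        rw [mem_closedShell_iff] at hx
        exact hinner x hx.1 h
      left_inv := fun x hx _ => hleft x (hshell_sub x hx) }

/-- **Extension of a cap germ over the ball.**  With the data of `CapBlend.lean`, there are an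
open `O ⊇ 𝔻̄`, a map `Λ` smooth and injective on `O` with `Λ(O)` open `⊇ 𝔻̄` and a smooth
inverse `Λinv` on `Λ(O)`, such that `Λ(𝔹) = 𝔹`, `Λ = id` on the unit sphere, and `Λ` agrees with
the blend `b = id + ρ (ι - id)` at every point of `O` of norm `> 1 - δ` (so `Λ = ι` there
wherever `ρ = 1`).  Inside, `Λ` is the extension of the inner collar `b` over the ball
(`IsInnerCollar.exists_openPartialHomeomorph_extend`; Hirsch (1976), Ch. 8, Thm. 1.8), outside
it is `b`. [cite: HirschDT1976, Ch. 8 §1, Thm. 1.8] -/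
theorem exists_ballPreserving_extension (hW₁ : IsOpen W₁) (hid : ∀ x ∈ W₁, ‖x‖ = 1 → ι x = x)
    (hin : ∀ x ∈ W₁, ‖x‖ < 1 → ‖ι x‖ < 1) (hι : ContDiff ℝ ∞ ι)
    (hDι : ∀ x, Injective (fderiv ℝ ι x))
    (hρs : ContDiffOn ℝ ∞ ρ {0}ᶜ) (hρ01 : ∀ x, ρ x ∈ Icc (0 : ℝ) 1)
    (hKc : IsCompact K) (hKW : K ⊆ W₁)
    (hρK : ∀ x : E, x ≠ 0 → ρ x ≠ 0 → ‖x‖⁻¹ • x ∈ K) :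
    ∃ (Λ Λinv : E → E) (O : Set E) (δ : ℝ), IsOpen O ∧ 0 < δ ∧ closedBall (0 : E) 1 ⊆ O ∧
      (∀ x : E, |‖x‖ - 1| < δ → x ∈ O) ∧
      ContDiffOn ℝ ∞ Λ O ∧ InjOn Λ O ∧ IsOpen (Λ '' O) ∧ closedBall (0 : E) 1 ⊆ Λ '' O ∧
      ContDiffOn ℝ ∞ Λinv (Λ '' O) ∧ (∀ x ∈ O, Λinv (Λ x) = x) ∧
      Λ '' ball (0 : E) 1 = ball 0 1 ∧ (∀ x : E, ‖x‖ = 1 → Λ x = x) ∧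
      (∀ x ∈ O, 1 - δ < ‖x‖ → Λ x = x + ρ x • (ι x - x)) := by
  obtain ⟨V, g, ε, hVo, hε, hε1, hV0, hshellV, hinjV, hopen, hshellIm, hgs, hleft, hright, hout, hinner, hcoll⟩ :=
    exists_isInnerCollar_blend hW₁ hid hin hι hDι hρs hρ01 hKc hKW hρK
  set b : E → E := fun x => x + ρ x • (ι x - x) with hb
  have hsph : ∀ p : E, ‖p‖ = 1 → b p = p := fun p hp => blend_eq_self_of_norm_eq_one hid hKW hρK hp
  obtain ⟨Θ, δ, hδ, hδε, hsrc, htgt, hΘs, hΘss, hΘeq, -⟩ := hcoll.exists_openPartialHomeomorph_extend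
  -- `Λ = Θ` inside, `b` outside
  set Λ : E → E := fun x => if ‖x‖ < 1 then Θ x else b x with hΛ
  set O : Set E := ball (0 : E) 1 ∪ (V ∩ {x | 1 - δ < ‖x‖ ∧ ‖x‖ < 1 + ε}) with hO
  have hOo : IsOpen O := isOpen_ball.union (hVo.inter
    ((isOpen_lt continuous_const continuous_norm).inter (isOpen_lt continuous_norm continuous_const)))
  -- `Λ = b` on `{1 - δ < ‖x‖}`
  have hΛb : ∀ x : E, 1 - δ < ‖x‖ → Λ x = b x := by
    intro x hx
    by_cases h1 : ‖x‖ < 1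
    · simp only [hΛ, if_pos h1]; exact hΘeq x hx.le h1
    · simp only [hΛ, if_neg h1]
  have hΛΘ : ∀ x : E, ‖x‖ < 1 → Λ x = Θ x := fun x hx => by simp only [hΛ, if_pos hx]
  -- the shell `{|‖x‖ - 1| < δ'}` lies in `O`
  have hδ' : ∀ x : E, |‖x‖ - 1| < min δ ε → x ∈ O := by
    intro x hx
    rw [abs_lt] at hx
    right
    exact ⟨hshellV x (by rw [abs_lt]; constructor <;> linarith [min_le_right δ ε, hx.1, hx.2]),
      by linarith [min_le_left δ ε, hx.1], by linarith [min_le_right δ ε, hx.2]⟩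
  have hcb : closedBall (0 : E) 1 ⊆ O := by
    intro x hx
    rw [mem_closedBall, dist_zero_right] at hx
    rcases hx.lt_or_eq with h | h
    · exact Or.inl (mem_ball_zero_iff.2 h)
    · exact hδ' x (by rw [h]; simp [lt_min hδ hε])
  -- smoothness
  have hΘmaps : ∀ x : E, ‖x‖ < 1 → ‖Θ x‖ < 1 := fun x hx => by
    have := Θ.map_source (x := x) (by rw [hsrc]; exact mem_ball_zero_iff.2 hx)
    rw [htgt] at this; exact mem_ball_zero_iff.1 this
  have hΛs : ContDiffOn ℝ ∞ Λ O := by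
    intro x hx
    by_cases h1 : ‖x‖ < 1
    · have hev : Λ =ᶠ[𝓝 x] Θ := by
        filter_upwards [isOpen_ball.mem_nhds (mem_ball_zero_iff.2 h1)] with y hy using hΛΘ y (mem_ball_zero_iff.1 hy)
      exact ((hΘs.contDiffAt (isOpen_ball.mem_nhds (mem_ball_zero_iff.2 h1))).congr_of_eventuallyEq hev).contDiffWithinAt
    · rcases hx with hx | ⟨hxV, hx1, hx2⟩
      · exact absurd (mem_ball_zero_iff.1 hx) h1
      · have hev : Λ =ᶠ[𝓝 x] b := by
          filter_upwards [(isOpen_lt continuous_const continuous_norm).mem_nhds hx1] with y hy using hΛb y hy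
        have hbx : ContDiffAt ℝ ∞ b x := (contDiffOn_blend hι hρs).contDiffAt (isOpen_compl_singleton.mem_nhds (hV0 hxV))
        exact (hbx.congr_of_eventuallyEq hev).contDiffWithinAt
  -- norms: `Λ` maps the ball into the ball, the sphere to itself, the outside part of `O` outside
  have hnorm_out : ∀ x ∈ O, ¬ ‖x‖ < 1 → 1 ≤ ‖Λ x‖ := by
    rintro x hx h1
    rw [hΛb x (by push Not at h1; linarith)]
    rcases hx with hx | ⟨hxV, hx1, hx2⟩
    · exact absurd (mem_ball_zero_iff.1 hx) h1
    · push Not at h1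
      rcases h1.lt_or_eq with hlt | heq
      · exact (hout x hlt hx2).le
      · rw [hsph x heq.symm, ← heq]
  -- injectivity
  have hinjΛ : InjOn Λ O := by
    intro x hx y hy hxy
    by_cases h1 : ‖x‖ < 1 <;> by_cases h2 : ‖y‖ < 1
    · rw [hΛΘ x h1, hΛΘ y h2] at hxy
      exact Θ.injOn (by rw [hsrc]; exact mem_ball_zero_iff.2 h1) (by rw [hsrc]; exact mem_ball_zero_iff.2 h2) hxy
    · exfalso
      have := hnorm_out y hy h2
      rw [← hxy, hΛΘ x h1] at this
      linarith [hΘmaps x h1]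
    · exfalso
      have := hnorm_out x hx h1
      rw [hxy, hΛΘ y h2] at this
      linarith [hΘmaps y h2]
    · push Not at h1 h2
      rw [hΛb x (by linarith), hΛb y (by linarith)] at hxy
      have hxV : x ∈ V := by
        rcases hx with hx | hx
        · exact absurd (mem_ball_zero_iff.1 hx) (not_lt.2 h1)
        · exact hx.1
      have hyV : y ∈ V := by
        rcases hy with hy | hy
        · exact absurd (mem_ball_zero_iff.1 hy) (not_lt.2 h2)
        · exact hy.1
      exact hinjV hxV hyV hxy
  -- images
  have himball : Λ '' ball (0 : E) 1 = ball 0 1 := by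
    ext y
    constructor
    · rintro ⟨x, hx, rfl⟩
      rw [hΛΘ x (mem_ball_zero_iff.1 hx)]
      exact mem_ball_zero_iff.2 (hΘmaps x (mem_ball_zero_iff.1 hx))
    · intro hy
      have hyt : y ∈ Θ.target := by rw [htgt]; exact hy
      refine ⟨Θ.symm y, by rw [← hsrc]; exact Θ.map_target hyt, ?_⟩
      rw [hΛΘ _ (by have := Θ.map_target hyt; rw [hsrc] at this; exact mem_ball_zero_iff.1 this)]
      exact Θ.right_inv hyt
  have hΛsph : ∀ x : E, ‖x‖ = 1 → Λ x = x := fun x hx => by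
    rw [hΛb x (by rw [hx]; linarith), hsph x hx]
  have himO : Λ '' O = ball (0 : E) 1 ∪ b '' (V ∩ {x | 1 - δ < ‖x‖ ∧ ‖x‖ < 1 + ε}) := by
    rw [hO, image_union, himball]
    congr 1
    refine image_congr fun x hx => hΛb x hx.2.1
  have himOo : IsOpen (Λ '' O) := by
    rw [himO]
    exact isOpen_ball.union (hopen _ (hVo.inter ((isOpen_lt continuous_const continuous_norm).inter
      (isOpen_lt continuous_norm continuous_const))) inter_subset_left)
  have hcbim : closedBall (0 : E) 1 ⊆ Λ '' O := by
    intro y hy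
    rw [mem_closedBall, dist_zero_right] at hy
    rcases hy.lt_or_eq with h | h
    · rw [himO]; exact Or.inl (mem_ball_zero_iff.2 h)
    · exact ⟨y, hcb (by rw [mem_closedBall, dist_zero_right, h]), hΛsph y h⟩
  -- the inverse
  set Λinv : E → E := fun y => if ‖y‖ < 1 then Θ.symm y else g y with hΛinv
  have hleftΛ : ∀ x ∈ O, Λinv (Λ x) = x := by
    intro x hx
    by_cases h1 : ‖x‖ < 1
    · have hΛx := hΛΘ x h1
      have : ‖Θ x‖ < 1 := hΘmaps x h1
      simp only [hΛinv, hΛx, if_pos this]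
      exact Θ.left_inv (by rw [hsrc]; exact mem_ball_zero_iff.2 h1)
    · have h1' := hnorm_out x hx h1
      simp only [hΛinv, if_neg (not_lt.2 h1')]
      rw [hΛb x (by push Not at h1; linarith)]
      have hxV : x ∈ V := by
        rcases hx with hx | hx
        · exact absurd (mem_ball_zero_iff.1 hx) h1
        · exact hx.1
      exact hleft x hxV
  -- smoothness of the inverse
  have hΛinvs : ContDiffOn ℝ ∞ Λinv (Λ '' O) := by
    intro y hy
    obtain ⟨x, hx, rfl⟩ := hy
    by_cases h1 : ‖Λ x‖ < 1
    · -- inside: `Λinv = Θ.symm` near `Λ x`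
      have hev : Λinv =ᶠ[𝓝 (Λ x)] Θ.symm := by
        filter_upwards [isOpen_ball.mem_nhds (mem_ball_zero_iff.2 h1)] with y hy
        simp only [hΛinv, if_pos (mem_ball_zero_iff.1 hy)]
      exact ((hΘss.contDiffAt (isOpen_ball.mem_nhds (mem_ball_zero_iff.2 h1))).congr_of_eventuallyEq hev).contDiffWithinAt
    · -- on or outside the sphere: `Λinv = g` near `Λ x`
      have hx1 : ¬ ‖x‖ < 1 := fun h => h1 (by rw [hΛΘ x h]; exact hΘmaps x h)
      have hxV : x ∈ V := by
        rcases hx with hx | hx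
        · exact absurd (mem_ball_zero_iff.1 hx) hx1
        · exact hx.1
      have hΛx : Λ x = b x := hΛb x (by push Not at hx1; linarith)
      have hyim : Λ x ∈ b '' V := by rw [hΛx]; exact ⟨x, hxV, rfl⟩
      have hgy : g (Λ x) = x := by rw [hΛx]; exact hleft x hxV
      -- near `Λ x`, points of the open ball have `Θ.symm = g`
      have hev : Λinv =ᶠ[𝓝 (Λ x)] g := by
        have hgc : ContinuousAt g (Λ x) := (hgs.contDiffAt ((hopen V hVo Subset.rfl).mem_nhds hyim)).continuousAt
        have h2 : ∀ᶠ y in 𝓝 (Λ x), 1 - δ < ‖g y‖ := by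
          refine hgc.preimage_mem_nhds ((isOpen_lt continuous_const continuous_norm).mem_nhds ?_)
          show 1 - δ < ‖g (Λ x)‖
          rw [hgy]; push Not at hx1; linarith
        have h2' : ∀ᶠ y in 𝓝 (Λ x), ‖g y‖ < 1 + ε := by
          refine hgc.preimage_mem_nhds ((isOpen_lt continuous_norm continuous_const).mem_nhds ?_)
          show ‖g (Λ x)‖ < 1 + ε
          rw [hgy]
          rcases hx with hx | hx
          · exact absurd (mem_ball_zero_iff.1 hx) hx1
          · exact hx.2.2
        have h3 : ∀ᶠ y in 𝓝 (Λ x), y ∈ b '' V := (hopen V hVo Subset.rfl).mem_nhds hyim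
        filter_upwards [h2, h2', h3] with y hy2 hy2' hy3
        by_cases hy1 : ‖y‖ < 1
        · simp only [hΛinv, if_pos hy1]
          obtain ⟨hbg, hgV⟩ := hright y hy3
          have hbg : b (g y) = y := hbg
          -- `g y` is in the inner shell, where `Θ = b`
          have hgn : ‖g y‖ < 1 := by
            by_contra hge
            push Not at hge
            rcases hge.lt_or_eq with hlt | heq
            · have h' : 1 < ‖b (g y)‖ := hout (g y) hlt hy2'
              rw [hbg] at h'; linarith
            · have h' : b (g y) = g y := hsph (g y) heq.symm
              rw [hbg] at h'
              rw [h', ← heq] at hy1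
              exact lt_irrefl _ hy1
          have hΘg : Θ (g y) = y := by rw [hΘeq (g y) hy2.le hgn]; exact hbg
          calc Θ.symm y = Θ.symm (Θ (g y)) := by rw [hΘg]
            _ = g y := Θ.left_inv (by rw [hsrc]; exact mem_ball_zero_iff.2 hgn)
        · simp only [hΛinv, if_neg hy1]
      exact ((hgs.contDiffAt ((hopen V hVo Subset.rfl).mem_nhds hyim)).congr_of_eventuallyEq hev).contDiffWithinAt
  exact ⟨Λ, Λinv, O, min δ ε, hOo, lt_min hδ hε, hcb, hδ', hΛs, hinjΛ, himOo, hcbim, hΛinvs, hleftΛ,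
    himball, hΛsph, fun x hx h => hΛb x (by linarith [min_le_left δ ε])⟩

end CapBlend

end Literature.Topology.FourManifolds

end
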